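import Summits.ResolutionOfSingularities.ResolutionOfSingularities.Theorems.WeightedInvariantContactCylinderCompatibility
import Summits.ResolutionOfSingularities.ResolutionOfSingularities.Theorems.WeightedInvariantContactCentreFiltrationEssSmooth
import HarnessLib

/-!
# The cylinder rule is compatible with essentially smooth local homomorphisms — UNCONDITIONAL ((o28) P3a-2 ∘ (o24-C))
# (door `HypersurfaceCentreConstruction`, stmt-ResolutionOfSingularities-19897; KEY `stub_localWeightedDropEFT4S`, regime P3a;
# res-type-005, res-L1-w43-plan-1 ORDER (o28) 2026-08-27T09:31:23Z)

Topic: `Summits/ResolutionOfSingularities/ResolutionOfSingularities/Theorems`. Helper for the door item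
`HypersurfaceCentreConstruction` (stmt-ResolutionOfSingularities-19897, route `WeightedInvariant`). The hypothesis
`hC : IotaJEssSmoothCompatibleLE2 iotaOrd jContact` of `ContactCylinder.cylinder_comap_eq_map` (p521270) is DISCHARGED by
res-type-078's (o24-C) closer `EssSmoothCentre.iotaJEssSmoothCompatibleLE2_iotaOrd_jContact` (p520664): for every essentially
smooth local homomorphism `S → S'` of regular local rings with `dim S ≤ 2` and `𝔭' = 𝔪_S S'` prime, the cylinder value
`(jContact (S'_{𝔭'}) f m) ∩ S'` equals `(jContact S f m)·S'` and `iotaOrd` is read at `S'_{𝔭'}` — the recorded dead end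
`S' = S[t]_(𝔪, t)` of the naive recipe included; and `𝔪_S S'` IS prime (`isPrime_map_maximalIdeal`: the closed fibre is a
regular local ring, res-type-070 p507256). [OURS · L1 W4.3 · (o28) P3a-2, unconditional]  Replaces the role of NO printed
item; NOT a statement of the manuscript [claim: Hironaka2017, status: under-review]. AI work, weaker than expert review.

## References

* H. Matsumura, Commutative Ring Theory (1987), Thm. 15.1, 16.2, 23.7. [Matsumura1987]
* V. Cossart, U. Jannsen, S. Saito, LNM 2270 (2020), Ch. 8. [CossartJannsenSaito2020]
-/

noncomputable section

open IsLocalRing Literature.AlgebraicGeometry.Resolution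
open Summit.ResolutionOfSingularities.ResolutionOfSingularities.Cruxes.HypersurfaceCentreConstruction.LocalEngine

set_option linter.dupNamespace false -- mandated namespace of this single-conjunct summit

namespace Summit.ResolutionOfSingularities.ResolutionOfSingularities.Theorems

namespace ContactCylinder

/-- **(P3a-2), unconditional.**  `S → S'` an essentially smooth local homomorphism of regular local rings (local, formally
smooth, essentially of finite type), `dim S ≤ 2`, `𝔭' = 𝔪_S S'` prime: `iotaOrd (S'_{𝔭'}) f = iotaOrd S f` and
`(jContact (S'_{𝔭'}) f m) ∩ S' = (jContact S f m)·S'` for all `m` (`cylinder_comap_eq_map` with res-type-078's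
`EssSmoothCentre.iotaJEssSmoothCompatibleLE2_iotaOrd_jContact`). [OURS · L1 W4.3 · (o28) P3a-2] -/
theorem cylinder_comap_eq_map_iotaOrd_jContact
    (S S' : Type) [CommRing S] [IsRegularLocalRing S] [CommRing S'] [IsRegularLocalRing S'] [Algebra S S']
    [IsLocalHom (algebraMap S S')] [Algebra.FormallySmooth S S'] [Algebra.EssFiniteType S S']
    (hS : ringKrullDim S ≤ 2) (𝔭' : Ideal S') [𝔭'.IsPrime] (h𝔭' : (maximalIdeal S).map (algebraMap S S') = 𝔭')
    (f : S) :
    iotaOrd (Localization.AtPrime 𝔭') (algebraMap S (Localization.AtPrime 𝔭') f) = iotaOrd S f ∧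
    ∀ m : ℕ, (jContact (Localization.AtPrime 𝔭') (algebraMap S (Localization.AtPrime 𝔭') f) m).comap
        (algebraMap S' (Localization.AtPrime 𝔭')) = (jContact S f m).map (algebraMap S S') :=
  cylinder_comap_eq_map EssSmoothCentre.iotaJEssSmoothCompatibleLE2_iotaOrd_jContact S S' hS 𝔭' h𝔭' f

/-- **`𝔪_S S'` is prime** for an essentially smooth local homomorphism of Noetherian local rings with `S` regular: the
closed fibre `S' ⧸ 𝔪_S S'` is a regular local ring (res-type-070's `isRegularLocalRing_fiber`, p507256), hence a domain.
So the hypothesis `h𝔭'` of the cylinder theorems is met by `𝔭' := 𝔪_S S'` itself. [folklore] -/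
theorem isPrime_map_maximalIdeal (S S' : Type) [CommRing S] [IsRegularLocalRing S] [CommRing S'] [IsLocalRing S']
    [IsNoetherianRing S'] [Algebra S S'] [IsLocalHom (algebraMap S S')] [Algebra.FormallySmooth S S']
    [Algebra.EssFiniteType S S'] : ((maximalIdeal S).map (algebraMap S S')).IsPrime := by
  haveI : IsRegularLocalRing (S' ⧸ (maximalIdeal S).map (algebraMap S S')) := isRegularLocalRing_fiber S S'
  haveI := isDomain_of_isRegularLocalRing (S' ⧸ (maximalIdeal S).map (algebraMap S S'))
  exact (Ideal.Quotient.isDomain_iff_prime _).mp inferInstance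

end ContactCylinder

end Summit.ResolutionOfSingularities.ResolutionOfSingularities.Theorems

end
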